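/-
Copyright: the b2b-balaban cell (near-miss cell 7), T⁴-continuum fan-out, lineage t4-ne7b-p1 (node U5c COUNT member).
Released under the licence of the surrounding project.
-/
import Summits.QuantumFields.BalabanUV.T4Continuum.Support.CrowdingAnalysis

/-!
# Crowding analysis, two-sequence form (crowding theorem, part 2′): multiplicity `m_t` against a weighted count `N_t`

Summits-side support leaf of the T⁴-continuum cell (rung (B)+1 on a FINITE torus only; NOT infinite volume, NOT the
mass gap, NOT the Clay statement; NOT a proof of the spine estimate NE7b).  Lineage `t4-ne7b-p1`, node U5c, wall (GM),
located item G-ne7bp1g18-2 part (II).  Pure real analysis, [folklore]; nothing quoted, nothing printed asserted.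

WHY.  Part 2 (`CrowdingAnalysis.cost_le`) bounds `Σ_t p·n_t·log Q(n, σ, t)` with the SAME sequence `n` as the
multiplicity of the cost and as the argument of the discounted crowding `Q`.  In the zone form of the placement
assembly the zone extents are FATNESS-WEIGHTED (a birth of class `d′` is `d′ + 1` cubes wide), so the crowding that
drives the cost is `Q(N, σ, t)` with the weighted count `N_t = Σ_{births at t} (d′ + 1) + m_t`, while the
multiplicity of the cost is the number of mergers `m_t ≤ N_t`.  This file proves the two-sequence estimate

  `cost_le₂`:  `m ≤ N` pointwise ⟹
      `Σ_{t ≤ T} p·m_t·log Q(N, σ, t) ≤ 2η·Σ_{t ≤ T} m_t √m_t + crowdA p σ η · Σ_{t ≤ T} N_t`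

for every `p ≥ 0`, `σ ∈ (0,1)`, `η > 0`, with the SAME constant `crowdA` as part 2: superlinearity is needed only
against the multiplicity `m_t`; the weighted count enters linearly (the polylog error is linear in `N_s`,
`polylog_le`).  Part 2's `cost_le` is the case `m = N` (not restated).  The proof is part 2's, line by line, with the matching run at
multiplicity `m_t` and log-size `log N_s`.

HONEST DEPENDENCY (cell): continuum YM on T⁴ ⇐ BetaPertH ∧ nine spine estimates (0/9 proved); BetaPertH ⇐ (D1) ∧ (D4)
∧ CAP+tail.  This file changes none of it.
-/

namespace Summit.QuantumFields.BalabanUV.T4Continuum.Crowding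

open Finset

noncomputable section

/-! ## §1 Termwise and matched forms with two sequences -/

/-- termwise scale decomposition at multiplicity `m_t ≤ N_t` (valid also when `m_t = 0`) [folklore] -/
theorem term_le₂ {p σ : ℝ} (hp : 0 ≤ p) (h0 : 0 < σ) (h1 : σ < 1) (m N : ℕ → ℕ) (t : ℕ) (hmN : m t ≤ N t) :
    p * m t * Real.log (Q N σ t) ≤
      p * m t * (-Real.log (1 - σ)) + ∑ s ∈ range (t + 1), p * m t * D N (-Real.log σ) s t := by
  rcases Nat.eq_zero_or_pos (m t) with ht | ht
  · simp [ht]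
  · rw [← mul_sum, ← mul_add]
    exact mul_le_mul_of_nonneg_left (log_Q_le h0 h1 N (le_trans ht hmN)) (by positivity)

/-- the matched form of one `(s,t)` term at multiplicity `m_t` and log-size `log N_s` [folklore] -/
theorem pair_le₂ {p σ η : ℝ} (hp : 0 ≤ p) (h0 : 0 < σ) (h1 : σ < 1) (hη : 0 < η) (m N : ℕ → ℕ) (s t : ℕ) :
    p * m t * D N (-Real.log σ) s t ≤
      η * (1 / ((t - s : ℕ) + 1 : ℝ) ^ 2) * (m t * Real.sqrt (m t)) +
        p ^ 3 / η ^ 2 * (((t - s : ℕ) + 1 : ℝ) ^ 4 *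
          (Real.log (N s) ^ 2 * max 0 (Real.log (N s) - ((t - s : ℕ) : ℝ) * (-Real.log σ)))) := by
  have hℓ : 0 < -Real.log σ := by linarith [Real.log_neg h0 h1]
  have hj : (0 : ℝ) < ((t - s : ℕ) + 1 : ℝ) := by positivity
  have hm := matching (p := p) (η := η * (1 / ((t - s : ℕ) + 1 : ℝ) ^ 2)) (N := (m t : ℝ)) (L := Real.log (N s))
    (d := D N (-Real.log σ) s t) hp (by positivity) (Nat.cast_nonneg _) (D_nonneg _ _ _ _) (D_le_log N hℓ.le s t)
  have he : p ^ 3 / (η * (1 / ((t - s : ℕ) + 1 : ℝ) ^ 2)) ^ 2 = p ^ 3 / η ^ 2 * ((t - s : ℕ) + 1 : ℝ) ^ 4 := by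
    field_simp
  rw [he] at hm
  unfold D at hm ⊢
  linarith [hm]

/-! ## §2 The two-sequence crowding estimate -/

/-- **THE CROWDING ESTIMATE, TWO-SEQUENCE FORM.**  For `p ≥ 0`, `σ ∈ (0,1)`, `η > 0`, all `m N : ℕ → ℕ` with
`m_t ≤ N_t` for every `t`, and every `T`:
`Σ_{t ≤ T} p·m_t·log Q(N, σ, t) ≤ 2η·Σ_{t ≤ T} m_t√m_t + crowdA p σ η · Σ_{t ≤ T} N_t`. [folklore] -/
theorem cost_le₂ {p σ η : ℝ} (hp : 0 ≤ p) (h0 : 0 < σ) (h1 : σ < 1) (hη : 0 < η) (m N : ℕ → ℕ)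
    (hmN : ∀ t, m t ≤ N t) (T : ℕ) :
    ∑ t ∈ range (T + 1), p * m t * Real.log (Q N σ t) ≤
      2 * η * ∑ t ∈ range (T + 1), (m t : ℝ) * Real.sqrt (m t) +
        crowdA p σ η * ∑ t ∈ range (T + 1), (N t : ℝ) := by
  set ℓ := -Real.log σ with hℓdef
  have hℓ : 0 < ℓ := by rw [hℓdef]; linarith [Real.log_neg h0 h1]
  set C := 40320 * Real.exp 1 * max 1 (1 / ℓ) ^ 8 with hCdef
  have hC : 0 ≤ C := by positivity
  set W : ℕ → ℕ → ℝ := fun s t => η * (1 / ((t - s : ℕ) + 1 : ℝ) ^ 2) * (m t * Real.sqrt (m t)) with hWdef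
  set E : ℕ → ℕ → ℝ := fun s t => p ^ 3 / η ^ 2 * (((t - s : ℕ) + 1 : ℝ) ^ 4 *
      (Real.log (N s) ^ 2 * max 0 (Real.log (N s) - ((t - s : ℕ) : ℝ) * ℓ))) with hEdef
  -- termwise
  have step12 : ∑ t ∈ range (T + 1), p * m t * Real.log (Q N σ t) ≤
      ∑ t ∈ range (T + 1), (p * m t * (-Real.log (1 - σ)) + ∑ s ∈ range (t + 1), (W s t + E s t)) := by
    refine sum_le_sum fun t _ => (term_le₂ hp h0 h1 m N t (hmN t)).trans
      (add_le_add le_rfl (sum_le_sum fun s _ => ?_))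
    exact pair_le₂ hp h0 h1 hη m N s t
  -- the `W` part
  have stepW : ∑ t ∈ range (T + 1), ∑ s ∈ range (t + 1), W s t ≤
      2 * η * ∑ t ∈ range (T + 1), (m t : ℝ) * Real.sqrt (m t) := by
    rw [mul_sum]
    refine sum_le_sum fun t _ => ?_
    have hw : ∑ s ∈ range (t + 1), 1 / ((t - s : ℕ) + 1 : ℝ) ^ 2 ≤ 2 := by
      have hr := sum_range_reflect (fun j => 1 / ((j : ℝ) + 1) ^ 2) (t + 1)
      simp only [Nat.add_sub_cancel] at hr
      rw [hr]
      have h2 := sum_inv_sq_le (m := t + 1) (Nat.succ_pos t)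
      have h3 : 0 ≤ 1 / ((t + 1 : ℕ) : ℝ) := by positivity
      linarith
    calc ∑ s ∈ range (t + 1), W s t
        = η * (m t * Real.sqrt (m t)) * ∑ s ∈ range (t + 1), 1 / ((t - s : ℕ) + 1 : ℝ) ^ 2 := by
          rw [hWdef, mul_sum]
          exact sum_congr rfl fun s _ => by ring
      _ ≤ η * (m t * Real.sqrt (m t)) * 2 := mul_le_mul_of_nonneg_left hw (by positivity)
      _ = 2 * η * ((m t : ℝ) * Real.sqrt (m t)) := by ring
  -- the `E` part
  have stepE : ∑ t ∈ range (T + 1), ∑ s ∈ range (t + 1), E s t ≤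
      p ^ 3 / η ^ 2 * C * ∑ s ∈ range (T + 1), (N s : ℝ) := by
    have hswap : ∑ t ∈ range (T + 1), ∑ s ∈ range (t + 1), E s t =
        ∑ s ∈ range (T + 1), ∑ t ∈ (range (T + 1)).filter (fun t => s ≤ t), E s t := by
      refine sum_comm' fun t s => ?_
      simp only [mem_range, mem_filter]
      omega
    rw [hswap, mul_sum]
    refine sum_le_sum fun s _ => ?_
    have hL : 0 ≤ Real.log (N s) := Real.log_natCast_nonneg (N s)
    have hes := error_sum_le hL hℓ ((range (T + 1)).filter fun t => s ≤ t) s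
      (fun t ht => (mem_filter.1 ht).2)
    have hpl := polylog_le hℓ (N s)
    calc ∑ t ∈ (range (T + 1)).filter (fun t => s ≤ t), E s t
        = p ^ 3 / η ^ 2 * ∑ t ∈ (range (T + 1)).filter (fun t => s ≤ t), ((t - s : ℕ) + 1 : ℝ) ^ 4 *
            (Real.log (N s) ^ 2 * max 0 (Real.log (N s) - ((t - s : ℕ) : ℝ) * ℓ)) := by
          rw [hEdef, mul_sum]
      _ ≤ p ^ 3 / η ^ 2 * ((Real.log (N s) / ℓ + 1) ^ 5 * Real.log (N s) ^ 3) :=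
          mul_le_mul_of_nonneg_left hes (by positivity)
      _ ≤ p ^ 3 / η ^ 2 * (C * N s) := mul_le_mul_of_nonneg_left (by rw [hCdef]; linarith [hpl]) (by positivity)
      _ = p ^ 3 / η ^ 2 * C * (N s : ℝ) := by ring
  -- the constant part: `Σ m_t ≤ Σ N_t`
  have hc0 : 0 ≤ p * (-Real.log (1 - σ)) := by
    have : Real.log (1 - σ) < 0 := Real.log_neg (by linarith) (by linarith)
    nlinarith
  have stepC : p * (-Real.log (1 - σ)) * ∑ t ∈ range (T + 1), (m t : ℝ) ≤
      p * (-Real.log (1 - σ)) * ∑ t ∈ range (T + 1), (N t : ℝ) :=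
    mul_le_mul_of_nonneg_left (sum_le_sum fun t _ => by exact_mod_cast hmN t) hc0
  -- assemble
  have hsplit : ∑ t ∈ range (T + 1), (p * m t * (-Real.log (1 - σ)) + ∑ s ∈ range (t + 1), (W s t + E s t)) =
      p * (-Real.log (1 - σ)) * ∑ t ∈ range (T + 1), (m t : ℝ) +
        (∑ t ∈ range (T + 1), ∑ s ∈ range (t + 1), W s t + ∑ t ∈ range (T + 1), ∑ s ∈ range (t + 1), E s t) := by
    rw [mul_sum, ← sum_add_distrib, ← sum_add_distrib]
    exact sum_congr rfl fun t _ => by rw [sum_add_distrib]; ring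
  have hA : crowdA p σ η = p * (-Real.log (1 - σ)) + p ^ 3 / η ^ 2 * C := by
    rw [crowdA, hCdef, hℓdef]
  rw [hA, add_mul]
  linarith [step12, stepW, stepE, stepC, hsplit]

/-! ## §3 Sanity (closed instance; not used elsewhere) -/

namespace Sanity

/-- with no mergers at all the cost vanishes and the estimate reads `0 ≤ 0 + crowdA·Σ N` -/
theorem cost_zero_mult {p σ η : ℝ} (hp : 0 ≤ p) (h0 : 0 < σ) (h1 : σ < 1) (hη : 0 < η) (N : ℕ → ℕ) (T : ℕ) :
    ∑ t ∈ range (T + 1), p * ((fun _ => 0 : ℕ → ℕ) t : ℕ) * Real.log (Q N σ t) ≤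
      2 * η * ∑ t ∈ range (T + 1), (((fun _ => 0 : ℕ → ℕ) t : ℕ) : ℝ) * Real.sqrt ((fun _ => 0 : ℕ → ℕ) t : ℕ) +
        crowdA p σ η * ∑ t ∈ range (T + 1), (N t : ℝ) :=
  cost_le₂ hp h0 h1 hη (fun _ => 0) N (fun _ => Nat.zero_le _) T

end Sanity

end

end Summit.QuantumFields.BalabanUV.T4Continuum.Crowding
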